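import Summits.SmoothPoincare4.SmoothPoincare4.Theses.InformationMetricHadamard
import Summits.SmoothPoincare4.SmoothPoincare4.Theorems.InformationMetricHadamardC0AhRecognitionStubFarCollarImmersive
import Summits.SmoothPoincare4.SmoothPoincare4.Theorems.InformationMetricHadamardC0AhRecognitionStubFarCollarIsFar
import Summits.SmoothPoincare4.SmoothPoincare4.Theorems.InformationMetricHadamardC0AhRecognitionStubNearestPointSpreadAux
import Summits.SmoothPoincare4.SmoothPoincare4.Theorems.InformationMetricHadamardC0AhRecognitionStubNearestPointSpreadAux2
import Summits.SmoothPoincare4.SmoothPoincare4.Theorems.InformationMetricHadamardC0AhRecognitionStubNearestPointSpreadAux3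

/-!
# Stub `stub_nearestPointSpread` of line `core-distance-morse` (crux `InformationMetricHadamard.C0AhRecognition`, stmt-SmoothPoincare4-6015)

**The `√2`-spread of nearest points (first lemma of idea `core-distance-morse`).** Under the collar
clauses of the crux — a smooth injective end collar `Ψ : N × (0,1) → W⁵` over a closed Riemannian
4-manifold `(N, gN)`, closure clause, `C⁰`-asymptotics of `G ∘ dΨ` to the cone `c (dl² + gN)/l²` —
there are `ρ < √2` and `t ∈ (0,1)` such that for every level `s < t`, every deep point
`y ∈ Ψ(N × (0,s))` and every two nearest points `k₁, k₂` of `y` on the far core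
`K_s = (Ψ(N × (0,s)))ᶜ`: `d_G(k₁,k₂) ≤ ρ · d_G(y, K_s)`. In fact `ρ = 1` works.

Proof (the Minkowski form of the lead's notes, `Cruxes/C0AhRecognition/NOTES.md`, 15:50Z): fix
`ε = 1/20`, and let `t` be below the asymptotics threshold `t(ε)` and the far-immersivity threshold
`t₀` (`Sketch.stub_farCollarImmersive`; deep points are then far, `Sketch.stub_farCollarIsFar`).
For `y = Ψ(x₀, λ₀)` with `T = d_G(y, K_s) < ∞` and `δ > 0`:
* the vertical segment gives `T ≤ κ₊ Λ`, `κ₊ = √((1+ε)c)`, `Λ = log(s/λ₀)`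
  (`helper_nearestPointSpread_vertical`);
* a near-minimiser from `y` to `kᵢ` first meets `K_s` on the slice, at a foot `Ψ(xᵢ, s)` within `δ`
  of `kᵢ`, and its initial segment lifts to a deep `C¹` path below level `s` of length `≤ T + δ`
  (`helper_nearestPointSpread_footLift`), so the horizontal budget with `r = 5/4`
  (`helper_nearestPointSpread_minkowski`) and `T ≤ κ₊ Λ`, `10 κ₊ ≤ 11 κ₋` give
  `d_{gN}(x₀, xᵢ) ≤ s (T/2 + 2δ)/κ₊` (`NearestPointSpread.budget_le`);
* the level-`s` path between the feet costs `≤ κ₊/s · d_{gN}(x₁,x₂)`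
  (`helper_nearestPointSpread_level`);
whence `d_G(k₁,k₂) ≤ 2δ + (T + 4δ)` for every `δ > 0`, i.e. `d_G(k₁,k₂) ≤ T`.
Everything is proved (kind = proof); no definitions.
-/

noncomputable section

-- the prescribed namespace `Summit.<P>.<Sub>.…` duplicates `SmoothPoincare4` (P = Sub)
set_option linter.dupNamespace false

open scoped Manifold ContDiff Topology ENNReal NNReal
open Set Function

namespace Summit.SmoothPoincare4.SmoothPoincare4.Cruxes.C0AhRecognition.CoreDistanceMorse

open Literature.Geometry.Lorentzian (PseudoRiemannianMetric)

namespace NearestPointSpread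

/-- Passing to the limit in a family of real bounds: if `d ≤ a + M δ` (read in `ℝ≥0∞`) for every
`δ > 0`, with `M > 0`, then `d ≤ a`. [folklore] -/
theorem le_ofReal_of_forall_pos_le {d : ℝ≥0∞} {a M : ℝ} (hM : 0 < M)
    (h : ∀ δ : ℝ, 0 < δ → d ≤ ENNReal.ofReal (a + M * δ)) : d ≤ ENNReal.ofReal a := by
  refine ENNReal.le_of_forall_pos_le_add fun e he _ ↦ ?_
  have hδ : 0 < (e : ℝ) / M := div_pos (by exact_mod_cast he) hM
  calc d ≤ ENNReal.ofReal (a + M * ((e : ℝ) / M)) := h _ hδ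
    _ = ENNReal.ofReal (a + e) := by rw [mul_div_cancel₀ _ hM.ne']
    _ ≤ ENNReal.ofReal a + ENNReal.ofReal e := ENNReal.ofReal_add_le
    _ = ENNReal.ofReal a + e := by rw [ENNReal.ofReal_coe_nnreal]

/-- The elementary budget inequality behind the `√2`-spread at `ε = 1/20`, `r = 5/4`: with
`κ₋ = √((1−ε)c)`, `κ₊ = √((1+ε)c)` (so `10 κ₊ ≤ 11 κ₋`) and `T ≤ κ₊ Λ`, the Minkowski budget
`s (r (T + δ) − κ₋ Λ)/(κ₋ √(r² − 1))` is at most `s (T/2 + 2δ)/κ₊`. [folklore] -/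
theorem budget_le {κm κp Tr δ Λ s : ℝ} (hκm : 0 < κm) (hκp : 0 < κp)
    (h1011 : 10 * κp ≤ 11 * κm) (hs : 0 < s) (hTr : 0 ≤ Tr) (hδ : 0 ≤ δ) (hΛ : Tr ≤ κp * Λ) :
    s * (5 / 4 * (Tr + δ) - κm * Λ) / (κm * Real.sqrt ((5 / 4) ^ 2 - 1)) ≤
      s * (Tr / 2 + 2 * δ) / κp := by
  have h34 : Real.sqrt ((5 / 4 : ℝ) ^ 2 - 1) = 3 / 4 := by
    rw [show (5 / 4 : ℝ) ^ 2 - 1 = (3 / 4) ^ 2 by norm_num]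
    exact Real.sqrt_sq (by norm_num)
  rw [h34, div_le_div_iff₀ (by positivity) hκp]
  have h1 : κm * Tr ≤ κm * (κp * Λ) := mul_le_mul_of_nonneg_left hΛ hκm.le
  have h2 : 10 * κp * Tr ≤ 11 * κm * Tr := mul_le_mul_of_nonneg_right h1011 hTr
  have h3 : 10 * κp * δ ≤ 11 * κm * δ := mul_le_mul_of_nonneg_right h1011 hδ
  have h4 : 0 ≤ κm * δ := mul_nonneg hκm.le hδ
  nlinarith [mul_le_mul_of_nonneg_left h1 hs.le, mul_le_mul_of_nonneg_left h2 hs.le,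
    mul_le_mul_of_nonneg_left h3 hs.le, mul_nonneg hs.le h4]

end NearestPointSpread

/-- **Stub N (`nearestPointSpread`).** Under the collar clauses of the crux (smooth injective end
collar over a closed Riemannian 4-manifold `(N, gN)`, co-compact far parts, closure clause,
`C⁰`-asymptotics to the cone `c (dl² + gN)/l²` with `c > 0`) there are `ρ < √2` and `t ∈ (0,1)` such
that for every `s < t`, every deep point `y ∈ Ψ(N × (0,s))` and every two nearest points `k₁, k₂` of
`y` on the far core `K_s = (Ψ(N × (0,s)))ᶜ`: `d_G(k₁, k₂) ≤ ρ · d_G(y, K_s)`; here `ρ = 1`.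
See the module docstring for the proof (vertical cost, first exit + lift + Minkowski budget at
`ε = 1/20`, `r = 5/4`, level comparison, `δ → 0`). [folklore] -/
theorem stub_nearestPointSpread
    (N : Type) [TopologicalSpace N] [T2Space N] [SecondCountableTopology N] [CompactSpace N]
    [ChartedSpace (EuclideanSpace ℝ (Fin 4)) N] [IsManifold (𝓡 4) ∞ N]
    (gN : PseudoRiemannianMetric (𝓡 4) ∞ (EuclideanSpace ℝ (Fin 4)) (TangentSpace (𝓡 4) : N → Type _))
    (hgN : gN.IsRiemannian)
    (W : Type) [TopologicalSpace W] [T2Space W] [SecondCountableTopology W]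
    [ChartedSpace (EuclideanSpace ℝ (Fin 5)) W] [IsManifold (𝓡 5) ∞ W]
    (G : PseudoRiemannianMetric (𝓡 5) ∞ (EuclideanSpace ℝ (Fin 5)) (TangentSpace (𝓡 5) : W → Type _))
    (hG : G.IsRiemannian) (c : ℝ) (Ψ : N × ℝ → W) (hc : 0 < c)
    (hcpt : ∀ (x : W) (r : NNReal), IsCompact {y : W | G.edist hG x y ≤ r})
    (hsm : ContMDiffOn ((𝓡 4).prod 𝓘(ℝ, ℝ)) (𝓡 5) ∞ Ψ (univ ×ˢ Ioo (0 : ℝ) 1))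
    (hinj : InjOn Ψ (univ ×ˢ Ioo (0 : ℝ) 1))
    (hco : ∀ t ∈ Ioo (0 : ℝ) 1, IsCompact (Ψ '' (univ ×ˢ Ioo (0 : ℝ) t))ᶜ)
    (hcl : ∀ t ∈ Ioo (0 : ℝ) 1, closure (Ψ '' (univ ×ˢ Ioo (0 : ℝ) t)) ⊆ Ψ '' (univ ×ˢ Ioo (0 : ℝ) 1))
    (hasym : ∀ ε : ℝ, 0 < ε → ∃ t ∈ Ioo (0 : ℝ) 1, ∀ (y : N) (l : ℝ), l ∈ Ioo (0 : ℝ) t →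
      ∀ (v : TangentSpace (𝓡 4) y) (σ : ℝ),
        |G.val (Ψ (y, l)) (mfderiv ((𝓡 4).prod 𝓘(ℝ, ℝ)) (𝓡 5) Ψ (y, l) (v, σ))
            (mfderiv ((𝓡 4).prod 𝓘(ℝ, ℝ)) (𝓡 5) Ψ (y, l) (v, σ)) -
          c * (σ ^ 2 + gN.val y v v) / l ^ 2| ≤ ε * (c * (σ ^ 2 + gN.val y v v) / l ^ 2)) :
    ∃ ρ : ℝ, ρ < Real.sqrt 2 ∧ ∃ t ∈ Ioo (0 : ℝ) 1, ∀ s ∈ Ioo (0 : ℝ) t,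
      ∀ y ∈ Ψ '' (univ ×ˢ Ioo (0 : ℝ) s),
      ∀ k₁ ∈ (Ψ '' (univ ×ˢ Ioo (0 : ℝ) s))ᶜ, ∀ k₂ ∈ (Ψ '' (univ ×ˢ Ioo (0 : ℝ) s))ᶜ,
        G.edist hG y k₁ = ⨅ k ∈ (Ψ '' (univ ×ˢ Ioo (0 : ℝ) s))ᶜ, G.edist hG y k →
        G.edist hG y k₂ = ⨅ k ∈ (Ψ '' (univ ×ˢ Ioo (0 : ℝ) s))ᶜ, G.edist hG y k →
        G.edist hG k₁ k₂ ≤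
          ENNReal.ofReal ρ * ⨅ k ∈ (Ψ '' (univ ×ˢ Ioo (0 : ℝ) s))ᶜ, G.edist hG y k := by
  have _ := hcpt
  have _ := hco
  -- `W` is a finite-dimensional Hausdorff manifold, hence locally compact and regular
  haveI : LocallyCompactSpace W := ChartedSpace.locallyCompactSpace (EuclideanSpace ℝ (Fin 5)) W
  -- thresholds: the asymptotics clause at `ε = 1/20`, far immersivity, deep points are far
  obtain ⟨tε, htε, hasyε⟩ := hasym (1 / 20) (by norm_num)
  obtain ⟨t₀, ht₀, himm⟩ := Sketch.stub_farCollarImmersive N gN hgN W G c Ψ hc hasym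
  have hfar := Sketch.stub_farCollarIsFar N gN hgN W G hG c Ψ hc hsm hinj ⟨t₀, ht₀, himm⟩ hasym
  refine ⟨1, (Real.lt_sqrt zero_le_one).2 (by norm_num), min tε t₀,
    ⟨lt_min htε.1 ht₀.1, (min_le_left _ _).trans_lt htε.2⟩, ?_⟩
  intro s hs y hy k₁ hk₁ k₂ hk₂ h₁ h₂
  have hstε : s < tε := hs.2.trans_le (min_le_left _ _)
  have hst₀ : s < t₀ := hs.2.trans_le (min_le_right _ _)
  have hs1 : s ∈ Ioo (0 : ℝ) 1 := ⟨hs.1, hst₀.trans ht₀.2⟩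
  obtain ⟨⟨x₀, lam0⟩, hx, rfl⟩ := hy
  haveI : Nonempty N := ⟨x₀⟩
  have hlam0 : lam0 ∈ Ioo (0 : ℝ) s := hx.2
  set K : Set W := (Ψ '' (univ ×ˢ Ioo (0 : ℝ) s))ᶜ with hK
  set T : ℝ≥0∞ := ⨅ k ∈ K, G.edist hG (Ψ (x₀, lam0)) k with hT
  rw [ENNReal.ofReal_one, one_mul]
  -- the case `T = ∞` is trivial
  rcases eq_or_ne T ⊤ with hTtop | hTfin
  · rw [hTtop]; exact le_top
  have hmin₁ : ∀ k' ∈ K, G.edist hG (Ψ (x₀, lam0)) k₁ ≤ G.edist hG (Ψ (x₀, lam0)) k' :=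
    fun k' hk' ↦ by rw [h₁]; exact iInf₂_le k' hk'
  have hmin₂ : ∀ k' ∈ K, G.edist hG (Ψ (x₀, lam0)) k₂ ≤ G.edist hG (Ψ (x₀, lam0)) k' :=
    fun k' hk' ↦ by rw [h₂]; exact iInf₂_le k' hk'
  have hfin₁ : G.edist hG (Ψ (x₀, lam0)) k₁ ≠ ⊤ := by rw [h₁]; exact hTfin
  have hfin₂ : G.edist hG (Ψ (x₀, lam0)) k₂ ≠ ⊤ := by rw [h₂]; exact hTfin
  -- vertical cost from above: `T ≤ κ₊ log(s/λ₀)`, as `Ψ(x₀, s) ∈ K_s`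
  have hKs : Ψ (x₀, s) ∈ K := by
    rintro ⟨q, hq, hqe⟩
    have heq := hinj ⟨mem_univ _, hq.2.1, hq.2.2.trans hs1.2⟩ ⟨mem_univ _, hs1⟩ hqe
    have h2 : q.2 < s := hq.2.2
    rw [heq] at h2
    exact lt_irrefl _ h2
  set κp : ℝ := Real.sqrt ((1 + 1 / 20) * c) with hκp
  set κm : ℝ := Real.sqrt ((1 - 1 / 20) * c) with hκm
  set Λ : ℝ := Real.log (s / lam0) with hΛ
  have hΛ0 : 0 ≤ Λ := Real.log_nonneg ((one_le_div hlam0.1).2 hlam0.2.le)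
  have hκp0 : 0 < κp := Real.sqrt_pos.2 (by positivity)
  have hκm0 : 0 < κm := Real.sqrt_pos.2 (by positivity)
  have h1011 : 10 * κp ≤ 11 * κm := by
    have ha : 10 * κp = Real.sqrt (10 ^ 2 * ((1 + 1 / 20) * c)) := by
      rw [hκp, Real.sqrt_mul (by norm_num : (0 : ℝ) ≤ 10 ^ 2), Real.sqrt_sq (by norm_num : (0 : ℝ) ≤ 10)]
    have hb : 11 * κm = Real.sqrt (11 ^ 2 * ((1 - 1 / 20) * c)) := by
      rw [hκm, Real.sqrt_mul (by norm_num : (0 : ℝ) ≤ 11 ^ 2), Real.sqrt_sq (by norm_num : (0 : ℝ) ≤ 11)]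
    rw [ha, hb]
    exact Real.sqrt_le_sqrt (by nlinarith)
  have hvert : T ≤ ENNReal.ofReal (κp * Λ) :=
    (iInf₂_le (Ψ (x₀, s)) hKs).trans (helper_nearestPointSpread_vertical N gN W G hG c Ψ hc hsm
      (1 / 20) tε (by norm_num) htε.2.le hasyε x₀ lam0 s hlam0.1 hlam0.2.le hstε)
  have hTr0 : 0 ≤ T.toReal := ENNReal.toReal_nonneg
  have hTrΛ : T.toReal ≤ κp * Λ := by
    have := ENNReal.toReal_mono ENNReal.ofReal_ne_top hvert
    rwa [ENNReal.toReal_ofReal (by positivity)] at this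
  have hspos : 0 < s := hs.1
  have hs0 : s ≠ 0 := hs.1.ne'
  have hκpne : κp ≠ 0 := hκp0.ne'
  -- one foot: first exit + lift (`footLift`), then the horizontal budget (`minkowski`, `r = 5/4`)
  have hfoot : ∀ {k : W}, k ∈ K → (∀ k' ∈ K, G.edist hG (Ψ (x₀, lam0)) k ≤ G.edist hG (Ψ (x₀, lam0)) k') →
      G.edist hG (Ψ (x₀, lam0)) k = T → ∀ {δ : ℝ}, 0 < δ →
      ∃ x : N, G.edist hG k (Ψ (x, s)) ≤ ENNReal.ofReal δ ∧
        gN.edist hgN x₀ x ≤ ENNReal.ofReal (s * (T.toReal / 2 + 2 * δ) / κp) := by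
    intro k hk hmin hkT δ hδ
    have hfin : G.edist hG (Ψ (x₀, lam0)) k ≠ ⊤ := by rw [hkT]; exact hTfin
    obtain ⟨x, β, U, τ, hkx, hUo, hτ0, hIU, hβ, hIoc, hβ0, hβτ, hL⟩ :=
      helper_nearestPointSpread_footLift N W G hG Ψ hsm hinj hcl t₀ ht₀ himm hfar s ⟨hs.1, hst₀⟩
        x₀ lam0 hlam0 k hk hmin hfin δ hδ
    rw [hkT] at hL
    have hdeep : ∀ ρ ∈ Icc (0 : ℝ) τ, (β ρ).2 ∈ Ioo (0 : ℝ) tε := fun ρ hρ ↦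
      ⟨(hIoc ρ hρ).1, (hIoc ρ hρ).2.trans_lt hstε⟩
    have hle : ∀ ρ ∈ Icc (0 : ℝ) τ, (β ρ).2 ≤ s := fun ρ hρ ↦ (hIoc ρ hρ).2
    have hclimb : (β 0).2 ≤ (β τ).2 := by
      rw [hβ0, hβτ]
      exact hlam0.2.le
    have hM := helper_nearestPointSpread_minkowski N gN hgN W G hG c Ψ hc hsm (1 / 20) tε
      (by norm_num) htε.2.le hasyε β U hUo 0 τ hτ0 hIU hβ hdeep s hle hclimb (T.toReal + δ) hL
      (5 / 4) (by norm_num)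
    rw [hβ0, hβτ] at hM
    have hBB : s * (5 / 4 * (T.toReal + δ) - κm * Λ) / (κm * Real.sqrt ((5 / 4) ^ 2 - 1)) ≤
        s * (T.toReal / 2 + 2 * δ) / κp :=
      NearestPointSpread.budget_le hκm0 hκp0 h1011 hs.1 hTr0 hδ.le hTrΛ
    exact ⟨x, hkx, hM.trans (ENNReal.ofReal_le_ofReal hBB)⟩
  -- the main estimate: `d(k₁,k₂) ≤ T + 6δ` for every `δ > 0`
  have key : ∀ δ : ℝ, 0 < δ → G.edist hG k₁ k₂ ≤ ENNReal.ofReal (T.toReal + 6 * δ) := by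
    intro δ hδ
    obtain ⟨x₁, hk₁x, hx₁⟩ := hfoot hk₁ hmin₁ h₁ hδ
    obtain ⟨x₂, hk₂x, hx₂⟩ := hfoot hk₂ hmin₂ h₂ hδ
    have hB₂0 : 0 ≤ s * (T.toReal / 2 + 2 * δ) / κp := by positivity
    set B₂ : ℝ := s * (T.toReal / 2 + 2 * δ) / κp with hB₂
    have hlevel : G.edist hG (Ψ (x₁, s)) (Ψ (x₂, s)) ≤
        ENNReal.ofReal (κp / s) * (ENNReal.ofReal B₂ + ENNReal.ofReal B₂) := by
      refine (helper_nearestPointSpread_level N gN hgN W G hG c Ψ hc hsm (1 / 20) tε (by norm_num)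
        htε.2.le hasyε s ⟨hs.1, hstε⟩ x₁ x₂).trans ?_
      gcongr
      calc gN.edist hgN x₁ x₂ ≤ gN.edist hgN x₁ x₀ + gN.edist hgN x₀ x₂ :=
            PseudoRiemannianMetric.edist_triangle hgN _ _ _
        _ ≤ _ := add_le_add (by rw [PseudoRiemannianMetric.edist_comm]; exact hx₁) hx₂
    have hsκ : 0 ≤ κp / s := by positivity
    calc G.edist hG k₁ k₂ ≤ G.edist hG k₁ (Ψ (x₁, s)) + G.edist hG (Ψ (x₁, s)) k₂ :=
          PseudoRiemannianMetric.edist_triangle hG _ _ _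
      _ ≤ G.edist hG k₁ (Ψ (x₁, s)) +
            (G.edist hG (Ψ (x₁, s)) (Ψ (x₂, s)) + G.edist hG (Ψ (x₂, s)) k₂) := by
          gcongr
          exact PseudoRiemannianMetric.edist_triangle hG _ _ _
      _ ≤ ENNReal.ofReal δ +
            (ENNReal.ofReal (κp / s) * (ENNReal.ofReal B₂ + ENNReal.ofReal B₂) + ENNReal.ofReal δ) := by
          have hk₂x' : G.edist hG (Ψ (x₂, s)) k₂ ≤ ENNReal.ofReal δ := by
            rw [PseudoRiemannianMetric.edist_comm]; exact hk₂x
          gcongr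
      _ = ENNReal.ofReal (δ + (κp / s * (B₂ + B₂) + δ)) := by
          rw [ENNReal.ofReal_add hδ.le (by positivity), ENNReal.ofReal_add (by positivity) hδ.le,
            ENNReal.ofReal_mul hsκ, ENNReal.ofReal_add hB₂0 hB₂0]
      _ ≤ ENNReal.ofReal (T.toReal + 6 * δ) := by
          refine ENNReal.ofReal_le_ofReal (le_of_eq ?_)
          rw [hB₂]
          field_simp
          ring
  have hfinal : G.edist hG k₁ k₂ ≤ ENNReal.ofReal T.toReal :=
    NearestPointSpread.le_ofReal_of_forall_pos_le (by norm_num : (0 : ℝ) < 6) key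
  rwa [ENNReal.ofReal_toReal hTfin] at hfinal

end Summit.SmoothPoincare4.SmoothPoincare4.Cruxes.C0AhRecognition.CoreDistanceMorse

end
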